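import Summits.CriticalPhenomena.PercolationContinuityZ3.Theorems.PercNearOneGluingNoHeavyConstsClusterSquareApexGap
import HarnessLib

/-!
# The two endgames for an outerplanar graph plus one APEX inside a face: no double linkage at a cluster of `a`

builds on p205010 (kernel theorem, internal audit signed; external expert review pending)

PAPER-2 track "percolation constants", part (ii), seat `prim-consts-1`, gen 20 (lane index
`run/shared/lean/prim/consts/CONSTANTS.md`, row A19; memo `FROM-prim-consts-1-g20-APEX-FACE.md`).
Support file for the crux `NoHeavyLowerTail` (stmt-CriticalPhenomena-4575; `--supports`).  Theorems only; no definitions, no sorries.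

Setting of `…ConstsClusterSquareApexGap.lean`: `H` on `Fin n`, apex `h`, rim positions `pos` (injective on the rim), auxiliary rim
graph `G₀` and hub-contracted graph `H'` with no `H'`-edge crossing a `G₀`-edge in the order cut open at the rim vertex `a`.  A
DOUBLE LINKAGE at an `H`-connected `K ∋ a` consists of clash vertices `y ≠ y'` outside `K` (each joined to `K`) and `H`-walks
`y → b`, `y' → c` avoiding `K` with disjoint supports AND `y → c`, `y' → b` likewise (`b ≠ c` rim terminals outside `K`).
* `Consts.Apex.false_of_linked_rim`: impossible when `y, y'` are RIM vertices — the outerplanar endgame of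
  `Consts.NonCrossing.unlinked` verbatim, with the master gap lemma `Consts.Apex.cnt_eq_of_walk` (the apex may lie in `K` or on the
  walks; it has no position and is never counted).
* `Consts.Apex.false_of_linked_hub`: impossible when `y = h` is the APEX (`h ∉ K`, `y' = z` on the rim): with `x₁, x₂` the second
  vertices of the walks `h → s`, `h → t`, the four walks put `x₁, s, z, t, x₂` in one gap of `K`; the sets `K ∪ {z}`,
  `K ∪ supp(h → s)`, `K ∪ supp(h → t)` force `z` strictly between `s` and `t`, hence strictly between the apex-neighbours `x₁` and
  `x₂`, so the rim edge `{k', z}` (`k' ∈ K`, outside the gap) interleaves the chord `{x₁, x₂}` of `H'` — a forbidden crossing.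
The order-theoretic steps are isolated as `omega` lemmas `arith_hub₁–₃`.  `…ConstsClusterSquareApex.lean` assembles the two
endgames into `Consts.Apex.unlinked` and the CSQ/DUU/TS corollaries.
References: N. Gladkov, arXiv:2408.08457v2 (2024) (two-copy vdBK behind `…ClusterSquareUnlinked`); G. Chartrand, F. Harary,
Ann. Inst. H. Poincaré B 3 (1967) 433–438 (outerplanar graphs).
-/

noncomputable section

open Classical

namespace Summit.CriticalPhenomena.PercolationContinuityZ3.Theorems

open MeasureTheory Finset Literature.Probability.LatticeModels Literature.Probability.Percolation

namespace Consts

namespace Apex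

variable {n m : ℕ} {pos : Fin n → Fin m} {h : Fin n}

/-- Order fact 1 of the hub endgame: if neither `S` nor `T` lies strictly between `Z` and the other, `Z` lies strictly between
`S` and `T`. [folklore] -/
private theorem arith_hub₁ {Z S T : ℕ} (dZS : Z ≠ S) (dZT : Z ≠ T) (dST : S ≠ T)
    (iv1 : ¬ (Z < S ∧ S < T) ∧ ¬ (T < S ∧ S < Z)) (iv2 : ¬ (Z < T ∧ T < S) ∧ ¬ (S < T ∧ T < Z)) :
    (S < Z ∧ Z < T) ∨ (T < Z ∧ Z < S) := by
  omega

/-- Order fact 2 of the hub endgame: `Z` strictly between `S` and `T`, not strictly between `X₁, S` nor between `X₂, T`, puts `Z`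
strictly between `X₁` and `X₂`. [folklore] -/
private theorem arith_hub₂ {Z S T X₁ X₂ : ℕ} (d1Z : X₁ ≠ Z) (d2Z : X₂ ≠ Z)
    (hz : (S < Z ∧ Z < T) ∨ (T < Z ∧ Z < S))
    (i1 : ¬ (X₁ < Z ∧ Z < S) ∧ ¬ (S < Z ∧ Z < X₁)) (i2 : ¬ (X₂ < Z ∧ Z < T) ∧ ¬ (T < Z ∧ Z < X₂)) :
    (X₁ < Z ∧ Z < X₂) ∨ (X₂ < Z ∧ Z < X₁) := by
  omega

/-- Order fact 3 of the hub endgame: with `Z` strictly between `X₁` and `X₂` and `K'` not between them, the pair `{K', Z}`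
interleaves `{X₁, X₂}`. [folklore] -/
private theorem arith_hub₃ {Z X₁ X₂ K' : ℕ} (dK1 : K' ≠ X₁) (dK2 : K' ≠ X₂)
    (hz : (X₁ < Z ∧ Z < X₂) ∨ (X₂ < Z ∧ Z < X₁)) (kg : ¬ (X₁ < K' ∧ K' < X₂) ∧ ¬ (X₂ < K' ∧ K' < X₁)) :
    (K' < X₁ ∧ X₁ < Z ∧ Z < X₂) ∨ (X₁ < Z ∧ Z < X₂ ∧ X₂ < K') ∨ (K' < X₂ ∧ X₂ < Z ∧ Z < X₁) ∨
      (X₂ < Z ∧ Z < X₁ ∧ X₁ < K') := by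
  omega

section Endgame

variable {H G₀ H' : SimpleGraph (Fin n)} {a : Fin n}
  (hpos : ∀ u v, u ≠ h → v ≠ h → pos u = pos v → u = v)
  (g1 : ∀ u v, H.Adj u v → u ≠ h → v ≠ h → G₀.Adj u v)
  (g2 : ∀ u v, H.Adj u v → u ≠ h → v ≠ h → H'.Adj u v)
  (g3 : ∀ u v, u ≠ v → u ≠ h → v ≠ h → H.Adj h u → H.Adj h v → H'.Adj u v)
  (x1 : ∀ p q r s : Fin n, H'.Adj p q → G₀.Adj r s → (pos p - pos a).val < (pos r - pos a).val →
    (pos r - pos a).val < (pos q - pos a).val → (pos q - pos a).val < (pos s - pos a).val → False)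
  (x2 : ∀ p q r s : Fin n, G₀.Adj p q → H'.Adj r s → (pos p - pos a).val < (pos r - pos a).val →
    (pos r - pos a).val < (pos q - pos a).val → (pos q - pos a).val < (pos s - pos a).val → False)
  (ha : a ≠ h)
include hpos g1 g2 g3 x1 x2 ha

/-- RIM ENDGAME: an `H`-connected `K ∋ a` with two RIM clash vertices `y ≠ y'` (each joined to `K`) cannot carry both linkages
`(y → b, y' → c)` and `(y → c, y' → b)` by walks avoiding `K`, disjoint within each pair (`b, c` on the rim).  The outerplanar
endgame of `Consts.NonCrossing.unlinked` with the master gap lemma `Consts.Apex.cnt_eq_of_walk`. [folklore: Jordan curve] -/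
theorem false_of_linked_rim {K : Set (Fin n)} (hKw : ∀ s ∈ K, ∃ W : H.Walk a s, ∀ v ∈ W.support, v ∈ K)
    {b c y y' k k' : Fin n} (hb : b ≠ h) (hc : c ≠ h) (hyh : y ≠ h) (hy'h : y' ≠ h)
    (hkK : k ∈ K) (hky : H.Adj k y) (hk'K : k' ∈ K) (hk'y' : H.Adj k' y')
    (hyb : y ≠ b) (hyc : y ≠ c) (hy'b : y' ≠ b) (hy'c : y' ≠ c) (hyy' : y ≠ y') (hbc : b ≠ c)
    (P₁ : H.Walk y b) (P₂ : H.Walk y' c) (hP₁ : ∀ x ∈ P₁.support, x ∉ K) (hP₂ : ∀ x ∈ P₂.support, x ∉ K)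
    (hPd : ∀ x, x ∈ P₁.support → x ∉ P₂.support)
    (Q₁ : H.Walk y c) (Q₂ : H.Walk y' b) (hQ₁ : ∀ x ∈ Q₁.support, x ∉ K) (hQ₂ : ∀ x ∈ Q₂.support, x ∉ K)
    (hQd : ∀ x, x ∈ Q₁.support → x ∉ Q₂.support) : False := by
  -- memberships in the four supports
  have hyP₁ : y ∈ P₁.support := P₁.start_mem_support
  have hbP₁ : b ∈ P₁.support := P₁.end_mem_support
  have hy'P₂ : y' ∈ P₂.support := P₂.start_mem_support
  have hcP₂ : c ∈ P₂.support := P₂.end_mem_support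
  have hyQ₁ : y ∈ Q₁.support := Q₁.start_mem_support
  have hcQ₁ : c ∈ Q₁.support := Q₁.end_mem_support
  have hy'Q₂ : y' ∈ Q₂.support := Q₂.start_mem_support
  have hbQ₂ : b ∈ Q₂.support := Q₂.end_mem_support
  -- distinct positions (cut open at `a`)
  have rbc : (pos b - pos a).val ≠ (pos c - pos a).val := fun e =>
    hbc (hpos b c hb hc (NonCrossing.rot_injective (pos a) e))
  have ryb : (pos y - pos a).val ≠ (pos b - pos a).val := fun e =>
    hyb (hpos y b hyh hb (NonCrossing.rot_injective (pos a) e))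
  have ryc : (pos y - pos a).val ≠ (pos c - pos a).val := fun e =>
    hyc (hpos y c hyh hc (NonCrossing.rot_injective (pos a) e))
  have ry'b : (pos y' - pos a).val ≠ (pos b - pos a).val := fun e =>
    hy'b (hpos y' b hy'h hb (NonCrossing.rot_injective (pos a) e))
  have ry'c : (pos y' - pos a).val ≠ (pos c - pos a).val := fun e =>
    hy'c (hpos y' c hy'h hc (NonCrossing.rot_injective (pos a) e))
  have ryy' : (pos y - pos a).val ≠ (pos y' - pos a).val := fun e =>
    hyy' (hpos y y' hyh hy'h (NonCrossing.rot_injective (pos a) e))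
  -- the sets `K ∪ {y}` and `K ∪ {y'}`
  have hSy := NonCrossing.walks_extend hKw hkK hky (SimpleGraph.Walk.nil : H.Walk y y)
  have hSy' := NonCrossing.walks_extend hKw hk'K hk'y' (SimpleGraph.Walk.nil : H.Walk y' y')
  have memy : ∀ v, v ∈ K ∪ {v | v ∈ (SimpleGraph.Walk.nil : H.Walk y y).support} ↔ v ∈ K ∨ v = y := fun v => by
    simp only [Set.mem_union, Set.mem_setOf_eq, SimpleGraph.Walk.support_nil, List.mem_singleton]
  have memy' : ∀ v, v ∈ K ∪ {v | v ∈ (SimpleGraph.Walk.nil : H.Walk y' y').support} ↔ v ∈ K ∨ v = y' := fun v => by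
    simp only [Set.mem_union, Set.mem_setOf_eq, SimpleGraph.Walk.support_nil, List.mem_singleton]
  -- F2: w.r.t. `K ∪ {y}`, the walks `P₂ : y' → c` and `Q₂ : y' → b` avoid it
  have F2c := cnt_eq_ends hpos g1 g2 g3 x1 x2 ha hSy
    (S' := {s | s ∈ K ∪ {v | v ∈ (SimpleGraph.Walk.nil : H.Walk y y).support} ∧ s ≠ h}) (fun _ => Iff.rfl) P₂
    (fun v hv hvS => by
      rcases (memy v).1 hvS with hvK | rfl
      · exact hP₂ v hv hvK
      · exact hPd _ hyP₁ hv) hy'h hc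
  have F2b := cnt_eq_ends hpos g1 g2 g3 x1 x2 ha hSy
    (S' := {s | s ∈ K ∪ {v | v ∈ (SimpleGraph.Walk.nil : H.Walk y y).support} ∧ s ≠ h}) (fun _ => Iff.rfl) Q₂
    (fun v hv hvS => by
      rcases (memy v).1 hvS with hvK | rfl
      · exact hQ₂ v hv hvK
      · exact hQd _ hyQ₁ hv) hy'h hb
  -- F3: w.r.t. `K ∪ {y'}`, the walks `P₁ : y → b` and `Q₁ : y → c` avoid it
  have F3b := cnt_eq_ends hpos g1 g2 g3 x1 x2 ha hSy'
    (S' := {s | s ∈ K ∪ {v | v ∈ (SimpleGraph.Walk.nil : H.Walk y' y').support} ∧ s ≠ h}) (fun _ => Iff.rfl) P₁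
    (fun v hv hvS => by
      rcases (memy' v).1 hvS with hvK | rfl
      · exact hP₁ v hv hvK
      · exact hPd _ hv hy'P₂) hyh hb
  have F3c := cnt_eq_ends hpos g1 g2 g3 x1 x2 ha hSy'
    (S' := {s | s ∈ K ∪ {v | v ∈ (SimpleGraph.Walk.nil : H.Walk y' y').support} ∧ s ≠ h}) (fun _ => Iff.rfl) Q₁
    (fun v hv hvS => by
      rcases (memy' v).1 hvS with hvK | rfl
      · exact hQ₁ v hv hvK
      · exact hQd _ hv hy'Q₂) hyh hc
  have hyS : y ∈ ({s | s ∈ K ∪ {v | v ∈ (SimpleGraph.Walk.nil : H.Walk y y).support} ∧ s ≠ h} : Set (Fin n)) :=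
    ⟨(memy y).2 (Or.inr rfl), hyh⟩
  have hy'S : y' ∈ ({s | s ∈ K ∪ {v | v ∈ (SimpleGraph.Walk.nil : H.Walk y' y').support} ∧ s ≠ h} : Set (Fin n)) :=
    ⟨(memy' y').2 (Or.inr rfl), hy'h⟩
  obtain ⟨G1, G2⟩ := NonCrossing.not_between_of_cnt_eq_pos' a _ F2c hyS
  obtain ⟨G3, G4⟩ := NonCrossing.not_between_of_cnt_eq_pos' a _ F2b hyS
  obtain ⟨G5, G6⟩ := NonCrossing.not_between_of_cnt_eq_pos' a _ F3b hy'S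
  obtain ⟨G7, G8⟩ := NonCrossing.not_between_of_cnt_eq_pos' a _ F3c hy'S
  -- so `y, y'` are the extreme points of `{y, y', b, c}`; the interleaved linkage crosses the other one
  rcases Nat.lt_or_gt_of_ne ryy' with hyy | hyy
  · rcases Nat.lt_or_gt_of_ne rbc with hbc' | hbc'
    · -- y < b < c < y' : `Q₂ : y' → b` avoids `K ∪ supp Q₁ ∋ c`
      have hS := NonCrossing.walks_extend hKw hkK hky Q₁
      have F := cnt_eq_ends hpos g1 g2 g3 x1 x2 ha hS (S' := {s | s ∈ K ∪ {v | v ∈ Q₁.support} ∧ s ≠ h})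
        (fun _ => Iff.rfl) Q₂ (fun v hv hvS => by
          rcases hvS with hvK | hvQ
          · exact hQ₂ v hv hvK
          · exact hQd v hvQ hv) hy'h hb
      exact NonCrossing.not_between_of_cnt_eq_pos a _ F.symm ⟨Or.inr hcQ₁, hc⟩ hbc' (by omega)
    · -- y < c < b < y' : `P₂ : y' → c` avoids `K ∪ supp P₁ ∋ b`
      have hS := NonCrossing.walks_extend hKw hkK hky P₁
      have F := cnt_eq_ends hpos g1 g2 g3 x1 x2 ha hS (S' := {s | s ∈ K ∪ {v | v ∈ P₁.support} ∧ s ≠ h})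
        (fun _ => Iff.rfl) P₂ (fun v hv hvS => by
          rcases hvS with hvK | hvP
          · exact hP₂ v hv hvK
          · exact hPd v hvP hv) hy'h hc
      exact NonCrossing.not_between_of_cnt_eq_pos a _ F.symm ⟨Or.inr hbP₁, hb⟩ hbc' (by omega)
  · rcases Nat.lt_or_gt_of_ne rbc with hbc' | hbc'
    · -- y' < b < c < y : `P₁ : y → b` avoids `K ∪ supp P₂ ∋ c`
      have hS := NonCrossing.walks_extend hKw hk'K hk'y' P₂
      have F := cnt_eq_ends hpos g1 g2 g3 x1 x2 ha hS (S' := {s | s ∈ K ∪ {v | v ∈ P₂.support} ∧ s ≠ h})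
        (fun _ => Iff.rfl) P₁ (fun v hv hvS => by
          rcases hvS with hvK | hvP
          · exact hP₁ v hv hvK
          · exact hPd v hv hvP) hyh hb
      exact NonCrossing.not_between_of_cnt_eq_pos a _ F.symm ⟨Or.inr hcP₂, hc⟩ hbc' (by omega)
    · -- y' < c < b < y : `Q₁ : y → c` avoids `K ∪ supp Q₂ ∋ b`
      have hS := NonCrossing.walks_extend hKw hk'K hk'y' Q₂
      have F := cnt_eq_ends hpos g1 g2 g3 x1 x2 ha hS (S' := {s | s ∈ K ∪ {v | v ∈ Q₂.support} ∧ s ≠ h})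
        (fun _ => Iff.rfl) Q₁ (fun v hv hvS => by
          rcases hvS with hvK | hvQ
          · exact hQ₁ v hv hvK
          · exact hQd v hv hvQ) hyh hc
      exact NonCrossing.not_between_of_cnt_eq_pos a _ F.symm ⟨Or.inr hbQ₂, hb⟩ hbc' (by omega)

/-- HUB ENDGAME: an `H`-connected `K ∋ a` avoiding the apex, with the APEX `h` and a rim vertex `z` as clash vertices (`k ~ h`,
`k' ~ z`, `k, k' ∈ K`), cannot carry both linkages `(h → s, z → t)` and `(h → t, z → s)` by walks avoiding `K`, disjoint within each
pair (`s ≠ t` on the rim).  The second vertices `x₁, x₂` of the two walks from `h` are apex-neighbours; the gap lemma puts `z`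
strictly between them in a common gap of `K`, so the rim edge `{k', z}` separates `x₁` from `x₂`. [folklore: Jordan curve] -/
theorem false_of_linked_hub {K : Set (Fin n)} (hKw : ∀ s ∈ K, ∃ W : H.Walk a s, ∀ v ∈ W.support, v ∈ K) (hhK : h ∉ K)
    {s t z k k' : Fin n} (hs : s ≠ h) (ht : t ≠ h) (hzh : z ≠ h)
    (hkK : k ∈ K) (hkh : H.Adj k h) (hk'K : k' ∈ K) (hk'z : H.Adj k' z) (hzs : z ≠ s) (hzt : z ≠ t) (hst : s ≠ t)
    (W₁ : H.Walk h s) (W₂ : H.Walk z t) (hW₁ : ∀ x ∈ W₁.support, x ∉ K) (hW₂ : ∀ x ∈ W₂.support, x ∉ K)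
    (hWd : ∀ x, x ∈ W₁.support → x ∉ W₂.support)
    (W₃ : H.Walk h t) (W₄ : H.Walk z s) (hW₃ : ∀ x ∈ W₃.support, x ∉ K) (hW₄ : ∀ x ∈ W₄.support, x ∉ K)
    (hWd' : ∀ x, x ∈ W₃.support → x ∉ W₄.support) : False := by
  cases W₁ with
  | nil => exact hs rfl
  | @cons _ x₁ _ hx₁ W₁' =>
  cases W₃ with
  | nil => exact ht rfl
  | @cons _ x₂ _ hx₂ W₃' =>
  -- the second vertices `x₁, x₂` (apex-neighbours on the rim, outside `K`)
  have hx₁h : x₁ ≠ h := fun e => hx₁.ne e.symm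
  have hx₂h : x₂ ≠ h := fun e => hx₂.ne e.symm
  have hx₁W : x₁ ∈ (SimpleGraph.Walk.cons hx₁ W₁').support := by simp
  have hx₂W : x₂ ∈ (SimpleGraph.Walk.cons hx₂ W₃').support := by simp
  have hsW : s ∈ (SimpleGraph.Walk.cons hx₁ W₁').support := SimpleGraph.Walk.end_mem_support _
  have htW : t ∈ (SimpleGraph.Walk.cons hx₂ W₃').support := SimpleGraph.Walk.end_mem_support _
  have hx₁K : x₁ ∉ K := hW₁ x₁ hx₁W
  have hx₂K : x₂ ∉ K := hW₃ x₂ hx₂W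
  have hk'h : k' ≠ h := fun e => hhK (e ▸ hk'K)
  have hx₁z : x₁ ≠ z := fun e => hWd x₁ hx₁W (e ▸ W₂.start_mem_support)
  have hx₂z : x₂ ≠ z := fun e => hWd' x₂ hx₂W (e ▸ W₄.start_mem_support)
  have hk'x₁ : k' ≠ x₁ := fun e => hx₁K (e ▸ hk'K)
  have hk'x₂ : k' ≠ x₂ := fun e => hx₂K (e ▸ hk'K)
  -- distinct positions
  have dZS : (pos z - pos a).val ≠ (pos s - pos a).val := fun e =>
    hzs (hpos z s hzh hs (NonCrossing.rot_injective (pos a) e))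
  have dZT : (pos z - pos a).val ≠ (pos t - pos a).val := fun e =>
    hzt (hpos z t hzh ht (NonCrossing.rot_injective (pos a) e))
  have dST : (pos s - pos a).val ≠ (pos t - pos a).val := fun e =>
    hst (hpos s t hs ht (NonCrossing.rot_injective (pos a) e))
  have d1Z : (pos x₁ - pos a).val ≠ (pos z - pos a).val := fun e =>
    hx₁z (hpos x₁ z hx₁h hzh (NonCrossing.rot_injective (pos a) e))
  have d2Z : (pos x₂ - pos a).val ≠ (pos z - pos a).val := fun e =>
    hx₂z (hpos x₂ z hx₂h hzh (NonCrossing.rot_injective (pos a) e))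
  have dK1 : (pos k' - pos a).val ≠ (pos x₁ - pos a).val := fun e =>
    hk'x₁ (hpos k' x₁ hk'h hx₁h (NonCrossing.rot_injective (pos a) e))
  have dK2 : (pos k' - pos a).val ≠ (pos x₂ - pos a).val := fun e =>
    hk'x₂ (hpos k' x₂ hk'h hx₂h (NonCrossing.rot_injective (pos a) e))
  -- (1) the gap of `K`: `x₁, s, z, t, x₂` have the same count
  have c1 := cnt_eq_of_walk hpos g1 g2 g3 x1 x2 ha hKw (S' := {v | v ∈ K ∧ v ≠ h}) (fun _ => Iff.rfl)
    (SimpleGraph.Walk.cons hx₁ W₁') hW₁ x₁ hx₁W s hsW hx₁h hs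
  have c2 := cnt_eq_ends hpos g1 g2 g3 x1 x2 ha hKw (S' := {v | v ∈ K ∧ v ≠ h}) (fun _ => Iff.rfl) W₂ hW₂ hzh ht
  have c3 := cnt_eq_of_walk hpos g1 g2 g3 x1 x2 ha hKw (S' := {v | v ∈ K ∧ v ≠ h}) (fun _ => Iff.rfl)
    (SimpleGraph.Walk.cons hx₂ W₃') hW₃ x₂ hx₂W t htW hx₂h ht
  have c4 := cnt_eq_ends hpos g1 g2 g3 x1 x2 ha hKw (S' := {v | v ∈ K ∧ v ≠ h}) (fun _ => Iff.rfl) W₄ hW₄ hzh hs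
  have kg := NonCrossing.not_between_of_cnt_eq_pos' a _ (c1.trans (c4.symm.trans (c2.trans c3.symm))) ⟨hk'K, hk'h⟩
  -- (2) `K ∪ {z}`: the walks from `h` avoid it, so `z` is not strictly between `x₁, s` nor between `x₂, t`
  have hSz := NonCrossing.walks_extend hKw hk'K hk'z (SimpleGraph.Walk.nil : H.Walk z z)
  have memz : ∀ v, v ∈ K ∪ {v | v ∈ (SimpleGraph.Walk.nil : H.Walk z z).support} ↔ v ∈ K ∨ v = z := fun v => by
    simp only [Set.mem_union, Set.mem_setOf_eq, SimpleGraph.Walk.support_nil, List.mem_singleton]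
  have hzS : z ∈ ({v | v ∈ K ∪ {v | v ∈ (SimpleGraph.Walk.nil : H.Walk z z).support} ∧ v ≠ h} : Set (Fin n)) :=
    ⟨(memz z).2 (Or.inr rfl), hzh⟩
  have i1 := NonCrossing.not_between_of_cnt_eq_pos' a _ (cnt_eq_of_walk hpos g1 g2 g3 x1 x2 ha hSz
    (S' := {v | v ∈ K ∪ {v | v ∈ (SimpleGraph.Walk.nil : H.Walk z z).support} ∧ v ≠ h}) (fun _ => Iff.rfl)
    (SimpleGraph.Walk.cons hx₁ W₁') (fun v hv hvS => by
      rcases (memz v).1 hvS with hvK | rfl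
      · exact hW₁ v hv hvK
      · exact hWd _ hv W₂.start_mem_support) x₁ hx₁W s hsW hx₁h hs) hzS
  have i2 := NonCrossing.not_between_of_cnt_eq_pos' a _ (cnt_eq_of_walk hpos g1 g2 g3 x1 x2 ha hSz
    (S' := {v | v ∈ K ∪ {v | v ∈ (SimpleGraph.Walk.nil : H.Walk z z).support} ∧ v ≠ h}) (fun _ => Iff.rfl)
    (SimpleGraph.Walk.cons hx₂ W₃') (fun v hv hvS => by
      rcases (memz v).1 hvS with hvK | rfl
      · exact hW₃ v hv hvK
      · exact hWd' _ hv W₄.start_mem_support) x₂ hx₂W t htW hx₂h ht) hzS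
  -- (3) `K ∪ supp(h → s)` and `K ∪ supp(h → t)`: `s ∉ (z, t)` and `t ∉ (z, s)`
  have hS₁ := NonCrossing.walks_extend hKw hkK hkh (SimpleGraph.Walk.cons hx₁ W₁')
  have iv1 := NonCrossing.not_between_of_cnt_eq_pos' a _ (cnt_eq_ends hpos g1 g2 g3 x1 x2 ha hS₁
    (S' := {v | v ∈ K ∪ {v | v ∈ (SimpleGraph.Walk.cons hx₁ W₁').support} ∧ v ≠ h}) (fun _ => Iff.rfl) W₂
    (fun v hv hvS => by
      rcases hvS with hvK | hvW
      · exact hW₂ v hv hvK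
      · exact hWd v hvW hv) hzh ht) ⟨Or.inr hsW, hs⟩
  have hS₃ := NonCrossing.walks_extend hKw hkK hkh (SimpleGraph.Walk.cons hx₂ W₃')
  have iv2 := NonCrossing.not_between_of_cnt_eq_pos' a _ (cnt_eq_ends hpos g1 g2 g3 x1 x2 ha hS₃
    (S' := {v | v ∈ K ∪ {v | v ∈ (SimpleGraph.Walk.cons hx₂ W₃').support} ∧ v ≠ h}) (fun _ => Iff.rfl) W₄
    (fun v hv hvS => by
      rcases hvS with hvK | hvW
      · exact hW₄ v hv hvK
      · exact hWd' v hvW hv) hzh hs) ⟨Or.inr htW, ht⟩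
  -- (4) the rim edge `{k', z}` interleaves the chord `{x₁, x₂}`
  have hG : G₀.Adj k' z := g1 k' z hk'z hk'h hzh
  rcases arith_hub₃ dK1 dK2 (arith_hub₂ d1Z d2Z (arith_hub₁ dZS dZT dST iv1 iv2) i1 i2) kg with
    ⟨l1, l2, l3⟩ | ⟨l1, l2, l3⟩ | ⟨l1, l2, l3⟩ | ⟨l1, l2, l3⟩
  · have hne : x₁ ≠ x₂ := fun e => by rw [e] at l2; omega
    exact x2 k' z x₁ x₂ hG (g3 x₁ x₂ hne hx₁h hx₂h hx₁ hx₂) l1 l2 l3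
  · have hne : x₁ ≠ x₂ := fun e => by rw [e] at l1; omega
    exact x1 x₁ x₂ z k' (g3 x₁ x₂ hne hx₁h hx₂h hx₁ hx₂) hG.symm l1 l2 l3
  · have hne : x₂ ≠ x₁ := fun e => by rw [e] at l2; omega
    exact x2 k' z x₂ x₁ hG (g3 x₂ x₁ hne hx₂h hx₁h hx₂ hx₁) l1 l2 l3
  · have hne : x₂ ≠ x₁ := fun e => by rw [e] at l1; omega
    exact x1 x₂ x₁ z k' (g3 x₂ x₁ hne hx₂h hx₁h hx₂ hx₁) hG.symm l1 l2 l3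

end Endgame

end Apex

end Consts

end Summit.CriticalPhenomena.PercolationContinuityZ3.Theorems
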